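import Summits.MatrixMultiplication.MatrixMultiplication.Theses.DefinableSTPPDichotomy

/-!
# `HexagonClearanceR` (crux stmt-MatrixMultiplication-17884): the proviso `ε ≤ ε₀` ALONE is
load-bearing, modulo the Bourgain–Chang nonlinear Roth theorem

Negative-side lemma from the standing disprover's crux attack (cdisprove cycle 1, 2026-08-17; work
file `Cruxes/HexagonClearanceR/Disproof.lean` §4).  The 2026-08-17 repair of the seam added two
provisos, `ε ≤ ε₀` and `q₁ ≤ ringChar F`.  `LoadBearingProvisos.lean` shows they cannot BOTH be
dropped; here we show that `ε ≤ ε₀` cannot be dropped EVEN IN LARGE CHARACTERISTIC, conditionally on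
one published theorem of additive combinatorics, taken as an explicit hypothesis (inlined, no new
definition in the tree):

* Bourgain–Chang 2017, Cor. 1.2 ("quadratic Roth theorem on `𝔽_p`"; J. Bourgain, M.-C. Chang,
  Nonlinear Roth type theorems in finite fields, Israel J. Math. 221 (2017), arXiv:1608.05448):
  `A ⊆ 𝔽_p`, `|A| = δp`, `δ > c₁ p^{−1/15}` ⟹ `≳ δ³p²` pairs `(x, y)`, `y ≠ 0`, with
  `x, x+y, x+y² ∈ A`; since `y = 1` accounts for `≤ p` of them, for `p` large there is one with
  `y ∉ {0, 1}`.  Hypothesis `hBC` below is exactly this consequence (threshold `C·p^{14/15}`).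
  (Improved exponents: Peluse 2018, Dong–Li–Sawin 2020; not needed.)

The witness is a NEW parasite shape, the MOMENT FAN in `F⁵` (labels `x ∈ I = F`, `e = 1`, `m = 5`):
  `A_x = {(0, x, 0, −x, −x)}`,  `B_x = F·(1, x, 0, 0, x²)`,  `C_x = (0,0,0,0,−x) + F·(0, 0, 1, x, x²)`.
Its colour classes are lines whose DIRECTIONS move with the label along conics, and this is what no
label-only (translate) parasite can do: the 3-distinct-label ("hexagon") relation acquires a cross
term.  Precisely (determinant identity `E = (j−i)(j−k)·[(k−i)² − (j−i)]`, found by a linear-algebra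
search and verified by brute force over `𝔽₅`, `𝔽₇` in the work folder):
  * every `≥ 2`-equal-label STPP pattern holds identically, in EVERY field (five coordinate
    equations; no characteristic condition);
  * labels `(i, j, k)` pairwise distinct violate the clause iff `(k − i)² = j − i`, i.e. iff
    `(i, k, j) = (x, x + y, x + y²)` with `y ∉ {0, 1}`;
  * mass `Σ_x (1·q·q)^{(2+ε)/3} = q^{1 + 2(2+ε)/3}`, which is `q^{5+η}` at `ε = 4 + 3η/2`.
So at `ε = 4 + 1/20`, `η = 1/30`, over `𝔽_p` with `p ≥ max(q₁, p₀, ⌈C⌉^{30})`, the hypotheses of the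
`ε₀`-free seam hold, while a fully-STPP `J` must avoid `x, x+y, x+y²` (`y ∉ {0,1}`), so
`|J| ≤ C p^{14/15} = C p^{28/30}`, whereas the conclusion `p⁵ < |J|·p^{4 + 1/30}` needs
`|J| > p^{29/30} ≥ C p^{28/30}` — contradiction.

Reading for the route: after the repair, `ε ≤ ε₀ (< 1)` is what keeps every thin-block parasite out
(their mass needs `ε > 1`: unequal block dimensions, BirthVetting (2)), and it is GENUINELY needed —
large characteristic does not clear nonlinear hexagon relations (power saving survives `p → ∞`),
only linear ones (Behrend).  Conversely `q₁ ≤ ringChar F` alone is not load-bearing modulo the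
recurrence principle of `Cruxes/PairwiseCurvedTilingsLC/LonelyTranslates.lean`.  Nothing here
refutes the crux itself (`¬R → LC`, Disproof.lean §0).

References: J. Bourgain, M.-C. Chang, Israel J. Math. 221 (2017) 853–867, Cor. 1.2; S. Peluse,
Israel J. Math. 228 (2018); H. Cohn, R. Kleinberg, B. Szegedy, C. Umans, FOCS 2005, Def. 5.1.
-/

set_option linter.dupNamespace false  -- `Summit.<S>.<S>.…` is the mandated namespace

namespace Summit.MatrixMultiplication.MatrixMultiplication.Theorems.HexagonClearanceR.Negative

open Finset FirstOrder FirstOrder.Language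
open Summit.MatrixMultiplication.MatrixMultiplication.Theses.DefinableSTPPDichotomy

/-- **`ε ≤ ε₀` alone is load-bearing for `HexagonClearanceR`, modulo Bourgain–Chang.**  Hypothesis
`hBC`: the quadratic Roth theorem on prime fields in the form "every `J ⊆ ℤ/p` with
`|J| > C p^{14/15}`, `p ≥ p₀` prime, contains `x, x+y, x+y·y` with `y ∉ {0,1}`" (Bourgain–Chang 2017
Cor. 1.2 with its count `≳ δ³p²`).  Conclusion: the NEGATION of the crux with the single edit
"`∃ ε₀ > 0, ∀ ε η, 0 < ε → ε ≤ ε₀ → 0 < η → …` replaced by `∀ ε η, 0 < ε → 0 < η → …`" (large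
characteristic `q₁ ≤ ringChar F`, the pairwise clause, the mass hypothesis and the `δ`-free
conclusion all verbatim).  Witness: the moment fan in `F⁵` over `𝔽_p` at `ε = 4 + 1/20`,
`η = 1/30` (module docstring). [folklore] -/
theorem hexagonClearanceR_false_without_eps0_of_nonlinearRoth
    (hBC : ∃ (C : ℝ) (p₀ : ℕ), ∀ p : ℕ, p₀ ≤ p → p.Prime → ∀ J : Finset (ZMod p),
      C * (p : ℝ) ^ ((14 : ℝ) / 15) < J.card →
        ∃ x y : ZMod p, y ≠ 0 ∧ y ≠ 1 ∧ x ∈ J ∧ x + y ∈ J ∧ x + y * y ∈ J) :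
    ¬ (∀ (e m k : ℕ) (φI : Language.ring.Formula (Fin e ⊕ Fin k))
        (φA φB φC : Language.ring.Formula ((Fin e ⊕ Fin m) ⊕ Fin k)),
        ∀ ε η : ℝ, 0 < ε → 0 < η → ∃ q₁ : ℕ,
          ∀ (F : Type) [Field F] [Fintype F] [FirstOrder.Ring.CompatibleRing F], q₁ ≤ ringChar F →
            ∀ (y : Fin k → F) (I : Finset (Fin e → F)) (A B C : (Fin e → F) → Finset (Fin m → F)),
              (∀ x, x ∈ I ↔ φI.Realize (Sum.elim x y)) →
              (∀ x v, v ∈ A x ↔ φA.Realize (Sum.elim (Sum.elim x v) y)) →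
              (∀ x v, v ∈ B x ↔ φB.Realize (Sum.elim (Sum.elim x v) y)) →
              (∀ x v, v ∈ C x ↔ φC.Realize (Sum.elim (Sum.elim x v) y)) →
              (∀ i ∈ I, ∀ j ∈ I, ∀ k ∈ I, (i = j ∨ j = k ∨ k = i) →
                ∀ s ∈ A k, ∀ s' ∈ A i, ∀ t ∈ B i, ∀ t' ∈ B j, ∀ u ∈ C j, ∀ u' ∈ C k,
                  (s' - s) + (t' - t) + (u' - u) = 0 → i = j ∧ j = k ∧ s = s' ∧ t = t' ∧ u = u') →
              (Fintype.card F : ℝ) ^ ((m : ℝ) + η) ≤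
                ∑ x ∈ I, (((A x).card * (B x).card * (C x).card : ℕ) : ℝ) ^ ((2 + ε) / 3) →
              ∃ J : Finset (Fin e → F), J ⊆ I ∧
                (∀ i ∈ J, ∀ j ∈ J, ∀ k ∈ J, ∀ s ∈ A k, ∀ s' ∈ A i, ∀ t ∈ B i, ∀ t' ∈ B j,
                  ∀ u ∈ C j, ∀ u' ∈ C k, (s' - s) + (t' - t) + (u' - u) = 0 →
                    i = j ∧ j = k ∧ s = s' ∧ t = t' ∧ u = u') ∧
                (Fintype.card F : ℝ) ^ (m : ℝ) <
                  ∑ x ∈ J, (((A x).card * (B x).card * (C x).card : ℕ) : ℝ) ^ ((2 + ε) / 3)) := by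
  intro H
  classical
  obtain ⟨C₀, p₀, hBC⟩ := hBC
  -- ring terms/formulas (label `x : Fin 1`, vector `v : Fin 5`, no parameters)
  let X : Language.ring.Term ((Fin 1 ⊕ Fin 5) ⊕ Fin 0) := Term.var (Sum.inl (Sum.inl 0))
  let V : Fin 5 → Language.ring.Term ((Fin 1 ⊕ Fin 5) ⊕ Fin 0) :=
    fun r => Term.var (Sum.inl (Sum.inr r))
  -- `φA : v₀ = 0 ∧ v₁ = x ∧ v₂ = 0 ∧ v₃ + x = 0 ∧ v₄ + x = 0`
  let φA : Language.ring.Formula ((Fin 1 ⊕ Fin 5) ⊕ Fin 0) :=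
    Term.equal (V 0) 0 ⊓ Term.equal (V 1) X ⊓ Term.equal (V 2) 0 ⊓ Term.equal (V 3 + X) 0 ⊓
      Term.equal (V 4 + X) 0
  -- `φB : v₁ = v₀·x ∧ v₂ = 0 ∧ v₃ = 0 ∧ v₄ = v₀·x·x`
  let φB : Language.ring.Formula ((Fin 1 ⊕ Fin 5) ⊕ Fin 0) :=
    Term.equal (V 1) (V 0 * X) ⊓ Term.equal (V 2) 0 ⊓ Term.equal (V 3) 0 ⊓
      Term.equal (V 4) (V 0 * X * X)
  -- `φC : v₀ = 0 ∧ v₁ = 0 ∧ v₃ = v₂·x ∧ v₄ + x = v₂·x·x`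
  let φC : Language.ring.Formula ((Fin 1 ⊕ Fin 5) ⊕ Fin 0) :=
    Term.equal (V 0) 0 ⊓ Term.equal (V 1) 0 ⊓ Term.equal (V 3) (V 2 * X) ⊓
      Term.equal (V 4 + X) (V 2 * X * X)
  obtain ⟨q₁, hq₁⟩ := H 1 5 0 ⊤ φA φB φC (4 + 1 / 20) (1 / 30) (by norm_num) (by norm_num)
  -- the constant of the Roth hypothesis, made `≥ 1`
  set C : ℝ := max C₀ 1 with hCdef
  have hC1 : 1 ≤ C := le_max_right _ _
  have hC0 : 0 < C := by linarith
  -- a prime `p ≥ max(q₁, p₀, ⌈C⌉^30)`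
  obtain ⟨p, hpge, hp⟩ := Nat.exists_infinite_primes (max q₁ (max p₀ (⌈C⌉₊ ^ 30)))
  haveI : Fact p.Prime := ⟨hp⟩
  have hpq₁ : q₁ ≤ p := (le_max_left _ _).trans hpge
  have hpp₀ : p₀ ≤ p := ((le_max_left _ _).trans (le_max_right _ _)).trans hpge
  have hpC : ⌈C⌉₊ ^ 30 ≤ p := ((le_max_right _ _).trans (le_max_right _ _)).trans hpge
  let F := ZMod p
  letI : FirstOrder.Ring.CompatibleRing F := FirstOrder.Ring.compatibleRingOfRing F
  have hchar : q₁ ≤ ringChar F := by rwa [ZMod.ringChar_zmod_n]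
  have hcardF : Fintype.card F = p := ZMod.card p
  have hQpos : (0 : ℝ) < Fintype.card F := by exact_mod_cast Fintype.card_pos
  have hQ1 : (1 : ℝ) < Fintype.card F := by exact_mod_cast Fintype.one_lt_card
  -- the moment fan
  let av : (Fin 1 → F) → (Fin 5 → F) := fun x => ![0, x 0, 0, -(x 0), -(x 0)]
  let bv : (Fin 1 → F) → F → (Fin 5 → F) := fun x b => ![b, b * x 0, 0, 0, b * x 0 * x 0]
  let cv : (Fin 1 → F) → F → (Fin 5 → F) :=
    fun x c => ![0, 0, c, c * x 0, c * x 0 * x 0 - x 0]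
  let A : (Fin 1 → F) → Finset (Fin 5 → F) := fun x => {av x}
  let B : (Fin 1 → F) → Finset (Fin 5 → F) := fun x => univ.image (bv x)
  let Cc : (Fin 1 → F) → Finset (Fin 5 → F) := fun x => univ.image (cv x)
  have bv_inj : ∀ x, Function.Injective (bv x) := fun x b b' h => by
    have := congrFun h 0; simpa [bv] using this
  have cv_inj : ∀ x, Function.Injective (cv x) := fun x c c' h => by
    have := congrFun h 2; simpa [cv] using this
  have cardA : ∀ x, (A x).card = 1 := fun x => card_singleton _
  have cardB : ∀ x, (B x).card = Fintype.card F := fun x => by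
    simp only [B, card_image_of_injective _ (bv_inj x), card_univ]
  have cardC : ∀ x, (Cc x).card = Fintype.card F := fun x => by
    simp only [Cc, card_image_of_injective _ (cv_inj x), card_univ]
  have memA : ∀ {x v}, v ∈ A x ↔ v = av x := fun {x v} => mem_singleton
  have memB : ∀ {x v}, v ∈ B x ↔ ∃ b, bv x b = v := fun {x v} => by simp [B]
  have memC : ∀ {x v}, v ∈ Cc x ↔ ∃ c, cv x c = v := fun {x v} => by simp [Cc]
  -- realisation lemmas
  have realA : ∀ (x : Fin 1 → F) (v : Fin 5 → F),
      v ∈ A x ↔ φA.Realize (Sum.elim (Sum.elim x v) ![]) := by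
    intro x v
    rw [memA]
    simp only [φA, V, X, av, Formula.realize_inf, Formula.realize_equal, Term.realize_var,
      Sum.elim_inl, Sum.elim_inr, FirstOrder.Ring.realize_add, FirstOrder.Ring.realize_zero,
      funext_iff, Fin.forall_fin_succ]
    simp [add_eq_zero_iff_eq_neg, and_assoc]
  have realB : ∀ (x : Fin 1 → F) (v : Fin 5 → F),
      v ∈ B x ↔ φB.Realize (Sum.elim (Sum.elim x v) ![]) := by
    intro x v
    rw [memB]
    simp only [φB, V, X, bv, Formula.realize_inf, Formula.realize_equal, Term.realize_var,
      Sum.elim_inl, Sum.elim_inr, FirstOrder.Ring.realize_mul, FirstOrder.Ring.realize_zero]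
    constructor
    · rintro ⟨b, rfl⟩
      simp
    · rintro ⟨⟨⟨h1, h2⟩, h3⟩, h4⟩
      refine ⟨v 0, ?_⟩
      funext r
      fin_cases r <;> simp [h1, h2, h3, h4]
  have realC : ∀ (x : Fin 1 → F) (v : Fin 5 → F),
      v ∈ Cc x ↔ φC.Realize (Sum.elim (Sum.elim x v) ![]) := by
    intro x v
    rw [memC]
    simp only [φC, V, X, cv, Formula.realize_inf, Formula.realize_equal, Term.realize_var,
      Sum.elim_inl, Sum.elim_inr, FirstOrder.Ring.realize_mul, FirstOrder.Ring.realize_add,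
      FirstOrder.Ring.realize_zero]
    constructor
    · rintro ⟨c, rfl⟩
      simp
    · rintro ⟨⟨⟨h1, h2⟩, h3⟩, h4⟩
      refine ⟨v 2, ?_⟩
      funext r
      fin_cases r <;> simp [h1, h2, h3]
      linear_combination -h4
  -- instantiate the `ε₀`-free seam at the fan
  have key := hq₁ F hchar ![] univ A B Cc (fun x => by simp) realA realB realC
  obtain ⟨J, -, hJstpp, hJmass⟩ := key
    (by
      intro i _ j _ k _ hcase s hs s' hs' t ht t' ht' u hu u' hu' hsum
      rw [memA] at hs hs'
      obtain ⟨b, rfl⟩ := memB.1 ht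
      obtain ⟨b', rfl⟩ := memB.1 ht'
      obtain ⟨c, rfl⟩ := memC.1 hu
      obtain ⟨c', rfl⟩ := memC.1 hu'
      subst hs hs'
      have e0 : b' - b = 0 := by have := congrFun hsum 0; simpa [av, bv, cv] using this
      have e1 : (i 0 - k 0) + (b' * j 0 - b * i 0) = 0 := by
        have := congrFun hsum 1; simpa [av, bv, cv] using this
      have e2 : c' - c = 0 := by
        have := congrFun hsum 2; simp [av, bv, cv] at this; linear_combination this
      have e3 : (-(i 0) + k 0) + (c' * k 0 - c * j 0) = 0 := by
        have := congrFun hsum 3; simp [av, bv, cv] at this; linear_combination this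
      have e4 : (-(i 0) + k 0) + (b' * j 0 * j 0 - b * i 0 * i 0) +
          ((c' * k 0 * k 0 - k 0) - (c * j 0 * j 0 - j 0)) = 0 := by
        have := congrFun hsum 4; simp [av, bv, cv] at this; linear_combination this
      have hb : b' = b := by linear_combination e0
      have hc : c' = c := by linear_combination e2
      subst hb hc
      have hijk : i 0 = j 0 ∧ j 0 = k 0 := by
        rcases hcase with h | h | h
        · have h0 := congrFun h 0
          exact ⟨h0, by linear_combination e1 + b' * h0 - h0⟩
        · have h0 := congrFun h 0
          exact ⟨by linear_combination (-1 : F) * e3 - c' * h0 - h0, h0⟩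
        · have h0 := congrFun h 0
          -- `k = i`: `b'(j-i) = 0`, `c'(i-j) = 0`, `(j-i)((b'-c')(j+i) + 1) = 0`
          by_contra hne
          have hji : j 0 - i 0 ≠ 0 := by
            intro h'
            exact hne ⟨by linear_combination -h', by linear_combination h' - h0⟩
          have hb0 : b' = 0 := by
            have : b' * (j 0 - i 0) = 0 := by linear_combination e1 + h0
            exact (mul_eq_zero.1 this).resolve_right hji
          have hc0 : c' = 0 := by
            have : c' * (i 0 - j 0) = 0 := by linear_combination e3 - (1 + c') * h0
            rcases mul_eq_zero.1 this with h' | h'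
            · exact h'
            · exact absurd (by linear_combination -h' : j 0 - i 0 = 0) hji
          subst hb0 hc0
          apply hji
          linear_combination e4
      have hij : i = j := funext fun l => by rw [Fin.fin_one_eq_zero l]; exact hijk.1
      have hjk : j = k := funext fun l => by rw [Fin.fin_one_eq_zero l]; exact hijk.2
      subst hij hjk
      exact ⟨rfl, rfl, rfl, rfl, rfl⟩)
    (by
      simp only [cardA, cardB, cardC, one_mul, sum_const, card_univ, Fintype.card_fun,
        Fintype.card_fin, pow_one, nsmul_eq_mul, Nat.cast_mul, Nat.cast_ofNat]
      rw [← sq, ← Real.rpow_natCast _ 2, ← Real.rpow_mul hQpos.le,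
        show (5 : ℝ) + 1 / 30 = 1 + (2 : ℕ) * ((2 + (4 + 1 / 20)) / 3) by norm_num,
        Real.rpow_add hQpos, Real.rpow_one])
  -- mass of `J`: `p⁵ < |J| · p^{121/30}`, so `|J| > p^{29/30}`
  simp only [cardA, cardB, cardC, one_mul, sum_const, nsmul_eq_mul, Nat.cast_mul,
    Nat.cast_ofNat] at hJmass
  rw [← sq, ← Real.rpow_natCast _ 2, ← Real.rpow_mul hQpos.le] at hJmass
  have hexp : (Fintype.card F : ℝ) ^ (5 : ℝ) =
      (Fintype.card F : ℝ) ^ ((29 : ℝ) / 30) *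
        (Fintype.card F : ℝ) ^ ((2 : ℕ) * ((2 + (4 + 1 / 20)) / 3) : ℝ) := by
    rw [← Real.rpow_add hQpos]; norm_num
  rw [hexp] at hJmass
  have hJlow : (Fintype.card F : ℝ) ^ ((29 : ℝ) / 30) < J.card :=
    lt_of_mul_lt_mul_right hJmass (Real.rpow_nonneg hQpos.le _)
  -- `C p^{14/15} ≤ p^{29/30}` because `p^{1/30} ≥ ⌈C⌉ ≥ C`
  have hp30 : C ≤ (Fintype.card F : ℝ) ^ ((1 : ℝ) / 30) := by
    have h1 : (C : ℝ) ≤ ⌈C⌉₊ := Nat.le_ceil C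
    have h2 : ((⌈C⌉₊ : ℕ) : ℝ) = (((⌈C⌉₊ ^ 30 : ℕ) : ℝ)) ^ ((1 : ℝ) / 30) := by
      push_cast
      rw [show (1 : ℝ) / 30 = ((30 : ℕ) : ℝ)⁻¹ by norm_num,
        Real.pow_rpow_inv_natCast (Nat.cast_nonneg _) (by norm_num)]
    have h3 : (((⌈C⌉₊ ^ 30 : ℕ) : ℝ)) ^ ((1 : ℝ) / 30) ≤ (Fintype.card F : ℝ) ^ ((1 : ℝ) / 30) := by
      apply Real.rpow_le_rpow (Nat.cast_nonneg _) _ (by norm_num)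
      rw [hcardF]; exact_mod_cast hpC
    linarith [h2 ▸ h3]
  have hJbig : C₀ * (p : ℝ) ^ ((14 : ℝ) / 15) < (J.image fun v : Fin 1 → F => v 0).card := by
    have hinj : Function.Injective fun v : Fin 1 → F => v 0 := fun v w h =>
      funext fun l => by rw [Fin.fin_one_eq_zero l]; exact h
    rw [card_image_of_injective _ hinj]
    have hq : (p : ℝ) = Fintype.card F := by rw [hcardF]
    calc C₀ * (p : ℝ) ^ ((14 : ℝ) / 15)
        ≤ C * (p : ℝ) ^ ((14 : ℝ) / 15) :=
          mul_le_mul_of_nonneg_right (le_max_left _ _) (Real.rpow_nonneg (Nat.cast_nonneg _) _)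
      _ ≤ (Fintype.card F : ℝ) ^ ((1 : ℝ) / 30) * (Fintype.card F : ℝ) ^ ((14 : ℝ) / 15) := by
          rw [hq]; exact mul_le_mul_of_nonneg_right hp30 (Real.rpow_nonneg hQpos.le _)
      _ = (Fintype.card F : ℝ) ^ ((29 : ℝ) / 30) := by
          rw [← Real.rpow_add hQpos]; norm_num
      _ < J.card := hJlow
  -- Bourgain–Chang: a progression `x, x + y, x + y²` (`y ∉ {0,1}`) inside the labels of `J`
  obtain ⟨x, y, hy0, hy1, hx, hxy, hxyy⟩ := hBC p hpp₀ hp _ hJbig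
  have lab : ∀ {a : F}, a ∈ J.image (fun v : Fin 1 → F => v 0) → (fun _ : Fin 1 => a) ∈ J := by
    intro a ha
    obtain ⟨v, hv, rfl⟩ := mem_image.1 ha
    have : (fun _ : Fin 1 => v 0) = v := funext fun l => by rw [Fin.fin_one_eq_zero l]
    rwa [this]
  have hi := lab hx
  have hk := lab hxy
  have hj := lab hxyy
  -- the violating hexagon: `i = x`, `j = x + y²`, `k = x + y`, `b = 1/y`, `c = 1/(y-1)`
  have hy1' : y - 1 ≠ 0 := sub_ne_zero.2 hy1
  set i : Fin 1 → F := fun _ => x with hidef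
  set j : Fin 1 → F := fun _ => x + y * y with hjdef
  set k : Fin 1 → F := fun _ => x + y with hkdef
  have hy1'' : (-1 : F) + y ≠ 0 := by intro h; apply hy1'; linear_combination h
  have hyinv : y⁻¹ * y = 1 := inv_mul_cancel₀ hy0
  have hzinv : ((-1 : F) + y)⁻¹ * (-1 + y) = 1 := inv_mul_cancel₀ hy1''
  have key := hJstpp i hi j hj k hk (av k) (memA.2 rfl) (av i) (memA.2 rfl)
    (bv i y⁻¹) (memB.2 ⟨_, rfl⟩) (bv j y⁻¹) (memB.2 ⟨_, rfl⟩)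
    (cv j ((-1 : F) + y)⁻¹) (memC.2 ⟨_, rfl⟩) (cv k ((-1 : F) + y)⁻¹) (memC.2 ⟨_, rfl⟩)
    (by
      funext r
      fin_cases r
      · simp [av, bv, cv]
      · simp [av, bv, cv, i, j, k]
        linear_combination y * hyinv
      · simp [av, bv, cv]
      · simp [av, bv, cv, i, j, k]
        linear_combination (-y) * hzinv
      · simp [av, bv, cv, i, j, k]
        linear_combination (2 * x * y + y ^ 3) * hyinv - y * (2 * x + y + y ^ 2) * hzinv)
  have hx0 : x = x + y * y := by simpa [i, j] using congrFun key.1 0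
  exact hy0 (mul_self_eq_zero.1 (by linear_combination -hx0))

end Summit.MatrixMultiplication.MatrixMultiplication.Theorems.HexagonClearanceR.Negative
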